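import Mathlib
import Literature.Geometry.Lorentzian.FinalEraPackage2
import Summits.FinalStateConjecture.FinalStateConjecture.Theses.DissipativeFinalMotions
import Summits.FinalStateConjecture.FinalStateConjecture.Theorems.DissipativeFinalMotionsDispersalFromBudget
import HarnessLib

/-!
# Route DissipativeFinalMotions — the budget of `RadiativeLyapunovBudget` is FALSE without the
# chart clauses (kinematic shadow; `--supports` stmt-FinalStateConjecture-10993)

The crux `RadiativeLyapunovBudget` (RLB) quantifies over admissible data, a maximal vacuum Cauchy
development with complete `𝓘⁺`, and the 31-clause rev-2 final-era package
(`CauchyDevelopment.IsFinalEra₂`): clauses 1–3 and 18–30 speak about the development and the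
charts `Ψ₀, Ψᵢ` (exterior region, late charts, far-zone flatness, near-zone pin, effacement,
localisation, clocks, exhaustion, anti-twin), clauses 4–17 and 31 only about the labels
`(Mᵢ, aᵢ)`, the constants and the worldlines `ξᵢ` (sub-extremality, signs, `C²` worldlines,
`δ`-floor, `V`-Lipschitz, integrable slack `β ≥ 0`, the near-Newtonian modulation law with `1PN`
slack `κ`, `r₊ < ρ₀`).

`budget_false_without_chart_clauses` records, sorry-free, that the WORLDLINE clauses 4–17 and 31
alone do NOT imply the budget conclusion of RLB: the eternal static pair `ξ₀ ≡ 0`, `ξ₁ ≡ p`,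
`‖p‖ = 1`, with `M ≡ 1`, `a ≡ 0`, `T = 0`, `δ = 1`, `V = 0`, `C₁ = 0`, `C₂ = 1`, `ρ₀ = 3`,
`κ = 1/2`, `β ≡ 0` satisfies all of them for all `t ≥ 0` (the Newtonian pull `Mⱼ/d² = 1` is paid
exactly by the `1PN`-shaped slack `κ Mⱼ (M₀ + M₁)/d³ = 1`), while a budget `E` for it would force
`‖ξ₀ − ξ₁‖ → ∞` by the landed support item `DispersalFromBudget` (`DispersalFromBudget_proof`),
contradicting `‖ξ₀(t) − ξ₁(t)‖ = 1`. Hence every proof of RLB must use the chart clauses 18–30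
together with the vacuum dynamics of the development (a "no eternal binary of certified holes"
theorem); cf. the structure theorem `radiativeLyapunovBudget_iff_packageDisperses`
(Theorems/DissipativeFinalMotionsRadiativeLyapunovBudgetIffDispersal.lean).
-/

-- the doubled `FinalStateConjecture.FinalStateConjecture` path component trips dupNamespace
set_option linter.dupNamespace false

noncomputable section

open scoped Manifold ContDiff Topology
open Filter Set MeasureTheory Literature.Geometry.Lorentzian

namespace Summit.FinalStateConjecture.FinalStateConjecture.Theorems.DissipativeFinalMotions

/-- **The budget is false without the chart clauses** (kinematic shadow of
`RadiativeLyapunovBudget`). It is NOT the case that for all labels, constants, worldlines and slack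
satisfying clauses 4–17 and 31 of the rev-2 final-era package `IsFinalEra₂` (sub-extremal labels;
`0 < δ`, `0 ≤ V < 1`, `0 ≤ C₁`, `1 ≤ C₂`, `0 < ρ₀`, `0 ≤ κ`; `C²` worldlines; `δ`-separation and
`V`-Lipschitz bound on `[T, ∞)`; `β ≥ 0` integrable on `[T, ∞)`; the modulation law
`‖ξ̈ᵢ + Σ_{j≠i} Mⱼ(ξᵢ − ξⱼ)/dᵢⱼ³‖ ≤ κ Σ_{j≠i} (Mⱼ/dᵢⱼ²)(‖ξ̇ᵢ‖² + ‖ξ̇ⱼ‖² + (Σₗ Mₗ)/dᵢⱼ) + β`;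
`r₊(Mᵢ, aᵢ) < ρ₀`) there is a budget `E`, antitone and bounded below on `[T, ∞)`, dropping by
`ε(D') > 0` within lag `L(D') ≥ 0` after every `D'`-close unit interval of two distinct labels.
Witness: the eternal static pair at unit distance with `M ≡ 1`, `a ≡ 0`, `κ = 1/2`, `β ≡ 0`;
a budget for it contradicts `DispersalFromBudget_proof`. [folklore] -/
theorem budget_false_without_chart_clauses : open Literature.Geometry.Lorentzian MeasureTheory Set in ¬ ∀ (N : ℕ) (M a : Fin N → ℝ) (T δ V C₁ C₂ ρ₀ κ : ℝ) (ξ : Fin N → ℝ → E3) (β : ℝ → ℝ), (∀ i, Kerr.IsSubextremal (M i) (a i)) ∧ 0 < δ ∧ 0 ≤ V ∧ V < 1 ∧ 0 ≤ C₁ ∧ 1 ≤ C₂ ∧ 0 < ρ₀ ∧ 0 ≤ κ ∧ (∀ i, ContDiff ℝ 2 (ξ i)) ∧ (∀ t, T ≤ t → ∀ i j, i ≠ j → δ ≤ ‖ξ i t - ξ j t‖) ∧ (∀ i s t, T ≤ s → s ≤ t → ‖ξ i t - ξ i s‖ ≤ V * (t - s)) ∧ IntegrableOn β (Ici T) ∧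 (∀ t, T ≤ t → 0 ≤ β t) ∧ (∀ t, T ≤ t → ∀ i, ‖deriv (deriv (ξ i)) t + ∑ j ∈ Finset.univ.erase i, (M j / ‖ξ i t - ξ j t‖ ^ 3) • (ξ i t - ξ j t)‖ ≤ κ * (∑ j ∈ Finset.univ.erase i, M j / ‖ξ i t - ξ j t‖ ^ 2 * (‖deriv (ξ i) t‖ ^ 2 + ‖deriv (ξ j) t‖ ^ 2 + (∑ l, M l) / ‖ξ i t - ξ j t‖)) + β t) ∧ (∀ i, Kerr.rPlus (M i) (a i) < ρ₀) → ∃ E : ℝ → ℝ, AntitoneOn E (Ici T) ∧ BddBelow (E '' Ici T) ∧ ∀ D' : ℝ, 0 < D' → ∃ ε L : ℝ, 0 < ε ∧ 0 ≤ L ∧ ∀ t, T ≤ t → ∀ i j, i ≠ j → (∀ s, t ≤ s → s ≤ t + 1 → ‖ξ i s - ξ j s‖ ≤ D') → E (t + L) ≤ E t - ε := by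
  intro h
  classical
  -- the witness: an eternal static pair at unit distance
  set p : E3 := EuclideanSpace.single (0 : Fin 3) (1 : ℝ) with hp_def
  have hp : ‖p‖ = 1 := by
    rw [hp_def]
    simp
  set ξ : Fin 2 → ℝ → E3 := fun i _ ↦ if i = 0 then 0 else p with hξ_def
  have hξ0 : ξ 0 = fun _ ↦ (0 : E3) := by
    funext t
    simp [hξ_def]
  have hξ1 : ξ 1 = fun _ ↦ p := by
    funext t
    simp [hξ_def]
  -- distances
  have hd01 : ∀ t, ‖ξ 0 t - ξ 1 t‖ = 1 := fun t ↦ by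
    rw [hξ0, hξ1, zero_sub, norm_neg, hp]
  have hd10 : ∀ t, ‖ξ 1 t - ξ 0 t‖ = 1 := fun t ↦ by
    rw [hξ0, hξ1, sub_zero, hp]
  -- derivatives of the (constant) worldlines vanish
  have hder0 : deriv (ξ 0) = fun _ ↦ (0 : E3) := by
    rw [hξ0]
    funext t
    exact deriv_const t (0 : E3)
  have hder1 : deriv (ξ 1) = fun _ ↦ (0 : E3) := by
    rw [hξ1]
    funext t
    exact deriv_const t p
  have hder20 : ∀ t, deriv (deriv (ξ 0)) t = 0 := fun t ↦ by
    rw [hder0]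
    exact deriv_const t (0 : E3)
  have hder21 : ∀ t, deriv (deriv (ξ 1)) t = 0 := fun t ↦ by
    rw [hder1]
    exact deriv_const t (0 : E3)
  -- the erased index sets over `Fin 2`
  have e0 : Finset.univ.erase (0 : Fin 2) = {1} := by decide
  have e1 : Finset.univ.erase (1 : Fin 2) = {0} := by decide
  -- the kinematic clauses for the witness (`M ≡ 1`, `a ≡ 0`, `T = 0`, `δ = 1`, `V = 0`,
  -- `C₁ = 0`, `C₂ = 1`, `ρ₀ = 3`, `κ = 1/2`, `β ≡ 0`)
  have hsub : ∀ i : Fin 2,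
      Kerr.IsSubextremal ((fun _ : Fin 2 ↦ (1 : ℝ)) i) ((fun _ : Fin 2 ↦ (0 : ℝ)) i) := by
    intro i
    show |(0 : ℝ)| < 1
    norm_num
  have hrp : ∀ i : Fin 2,
      Kerr.rPlus ((fun _ : Fin 2 ↦ (1 : ℝ)) i) ((fun _ : Fin 2 ↦ (0 : ℝ)) i) < 3 := by
    intro i
    show (1 : ℝ) + √(1 ^ 2 - 0 ^ 2) < 3
    norm_num
  have hC2 : ∀ i : Fin 2, ContDiff ℝ 2 (ξ i) := by
    refine Fin.forall_fin_two.2 ⟨?_, ?_⟩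
    · rw [hξ0]; exact contDiff_const
    · rw [hξ1]; exact contDiff_const
  have hsep : ∀ t : ℝ, (0 : ℝ) ≤ t → ∀ i j : Fin 2, i ≠ j → (1 : ℝ) ≤ ‖ξ i t - ξ j t‖ := by
    intro t _
    refine Fin.forall_fin_two.2 ⟨Fin.forall_fin_two.2 ⟨fun h01 ↦ absurd rfl h01, fun _ ↦ ?_⟩,
      Fin.forall_fin_two.2 ⟨fun _ ↦ ?_, fun h11 ↦ absurd rfl h11⟩⟩
    · exact (hd01 t).symm.le
    · exact (hd10 t).symm.le
  have hLip : ∀ (i : Fin 2) (s t : ℝ), (0 : ℝ) ≤ s → s ≤ t → ‖ξ i t - ξ i s‖ ≤ 0 * (t - s) := by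
    refine Fin.forall_fin_two.2 ⟨fun s t _ _ ↦ ?_, fun s t _ _ ↦ ?_⟩
    · rw [hξ0, sub_self, norm_zero, zero_mul]
    · rw [hξ1, sub_self, norm_zero, zero_mul]
  have hsum : ∑ l : Fin 2, (fun _ : Fin 2 ↦ (1 : ℝ)) l = 2 := by
    rw [Fin.sum_univ_two]
    norm_num
  have hmod : ∀ t : ℝ, (0 : ℝ) ≤ t → ∀ i : Fin 2, ‖deriv (deriv (ξ i)) t +
      ∑ j ∈ Finset.univ.erase i,
        ((fun _ : Fin 2 ↦ (1 : ℝ)) j / ‖ξ i t - ξ j t‖ ^ 3) • (ξ i t - ξ j t)‖ ≤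
      (1 / 2 : ℝ) * (∑ j ∈ Finset.univ.erase i,
        (fun _ : Fin 2 ↦ (1 : ℝ)) j / ‖ξ i t - ξ j t‖ ^ 2 *
          (‖deriv (ξ i) t‖ ^ 2 + ‖deriv (ξ j) t‖ ^ 2 +
            (∑ l, (fun _ : Fin 2 ↦ (1 : ℝ)) l) / ‖ξ i t - ξ j t‖)) + (fun _ : ℝ ↦ (0 : ℝ)) t := by
    intro t _
    refine Fin.forall_fin_two.2 ⟨?_, ?_⟩
    · -- label 0: Newtonian pull `M₁/d² = 1`, slack `κ M₁ (M₀ + M₁)/d³ = 1`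
      rw [hder20, e0, Finset.sum_singleton, Finset.sum_singleton, hder0, hder1, hsum, hd01 t,
        zero_add, norm_smul]
      have hn : ‖ξ 0 t - ξ 1 t‖ = 1 := hd01 t
      rw [hn]
      norm_num
    · rw [hder21, e1, Finset.sum_singleton, Finset.sum_singleton, hder0, hder1, hsum, hd10 t,
        zero_add, norm_smul]
      have hn : ‖ξ 1 t - ξ 0 t‖ = 1 := hd10 t
      rw [hn]
      norm_num
  -- feed the witness to the hypothesis
  obtain ⟨E, hanti, hbdd, hcoer⟩ := h 2 (fun _ ↦ 1) (fun _ ↦ 0) 0 1 0 0 1 3 (1 / 2) ξ (fun _ ↦ 0)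
    ⟨hsub, one_pos, le_rfl, one_pos, le_rfl, le_rfl, by norm_num, by norm_num, hC2, hsep, hLip,
      integrableOn_zero, fun _ _ ↦ le_rfl, hmod, hrp⟩
  -- a budget forces dispersal (landed support item), but the pair is static
  have hdisp : Tendsto (fun t ↦ ‖ξ 0 t - ξ 1 t‖) atTop atTop :=
    DispersalFromBudget_proof 2 0 0 ξ E hLip hanti hbdd hcoer 0 1 Fin.zero_ne_one
  obtain ⟨t, ht⟩ := (hdisp.eventually_gt_atTop 1).exists
  rw [hd01 t] at ht
  exact lt_irrefl _ ht

end Summit.FinalStateConjecture.FinalStateConjecture.Theorems.DissipativeFinalMotions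

end
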